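import Summits.AtomisticToContinuum.Crystallization.Theorems.PerronTransitivityUniformBindingRigidityCohesionA
import Literature.MathematicalPhysics.StatisticalMechanics.LennardJonesClusters

/-!
# The half-space core `(CORE)` cannot be proved at depth zero

Crux `Summit.AtomisticToContinuum.Crystallization.Theses.PerronTransitivity.UniformBindingRigidity`
(item stmt-AtomisticToContinuum-15099), line `registered`, skeleton `Cruxes/UniformBindingRigidity/Lines/birth.lean`
rev 3.  Its open cohesion stub is the `e*`-free half-space core

  `stub_halfSpaceCore : ∀ Y u, ‖u‖ = 1 → 0 ∈ Y → (Y is 1/4-separated) → (∀ q ∈ Y, ⟪q,u⟫ ≤ 0) →`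
  `  (∀ t, ∃ q ∈ Y, ⟪q,u⟫ < -t) → (∀ p ∈ Y, U_Y(p) ≤ -711/500) → False`,

`U_Y(p) = ∑'_{q ∈ Y, q ≠ p} V_LJ(dist p q)`.  This file is a TIGHTNESS lemma for that stub (a `-- Targets`-type
negative result, kernel-checked, no numerics): the DEPTH-ZERO strengthening — using the site bound at the top
site `p = 0` only — is FALSE.  Witness: the `21` points at distance exactly `1` from `0` in the closed lower
half-space with coordinates in `(1/5)ℤ³`,
`(±1,0,0), (0,±1,0), (±3/5,±4/5,0), (±4/5,±3/5,0), (0,0,-1), (±3/5,0,-4/5), (0,±3/5,-4/5), (±4/5,0,-3/5), (0,±4/5,-3/5)`,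
pairwise at distance `≥ √2/5 > 1/4`, together with `0` and the deep points `(0,0,-n)`, `n ≥ 2` (thickness),
form a `1/4`-separated thick half-space configuration `Y ∋ 0` whose top site is bound at
`U_Y(0) ≤ 21·V_LJ(1) = -7/4 < -711/500` (every other term is `≤ 0`).  Hence any proof of `(CORE)` must use
the site bound at sites other than the top site (depth `≥ 1`): the over-binding of `0` is paid for by the
crowded first shell, whose own sites are far from bound.  Because `(CORE)` is `e*`-free, this tightness
statement is certifiable without any lower bound on `e*` (contrast `Disproof.lean` §3).

Contents: §1 the integer shell and its `decide`d combinatorics; §2 the configuration `Y`, separation,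
half-space and thickness; §3 the top-site sum `≤ -7/4`; §4 the negations `core_depthZero_false`,
`core_depthZero_false'`.  All `[folklore]`.
-/

noncomputable section

namespace Summit.AtomisticToContinuum.Crystallization.Theorems.UniformBindingRigidity.Negative.DepthZero

open scoped BigOperators
open Literature.MathematicalPhysics.StatisticalMechanics
open Summit.AtomisticToContinuum.Crystallization.Theorems.ChargedEnergyGapNegative (E3)
open Summit.AtomisticToContinuum.Crystallization.Theorems.PerronTransitivityUniformBindingRigidity
  (summable_site)

/-! ## §1 The integer shell -/

/-- Squared Euclidean distance of integer triples. [folklore] -/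
def isq (a b : ℤ × ℤ × ℤ) : ℤ :=
  (a.1 - b.1) ^ 2 + (a.2.1 - b.2.1) ^ 2 + (a.2.2 - b.2.2) ^ 2

/-- The `21` shell points, scaled by `5`: integer triples of squared norm `25` with last coordinate `≤ 0`
(`12` on the equator, `1` pole, `8` at heights `-3, -4`). [folklore] -/
def shellZ : List (ℤ × ℤ × ℤ) :=
  [(5, 0, 0), (-5, 0, 0), (0, 5, 0), (0, -5, 0), (3, 4, 0), (3, -4, 0), (-3, 4, 0), (-3, -4, 0),
   (4, 3, 0), (4, -3, 0), (-4, 3, 0), (-4, -3, 0), (0, 0, -5), (3, 0, -4), (-3, 0, -4), (0, 3, -4),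
   (0, -3, -4), (4, 0, -3), (-4, 0, -3), (0, 4, -3), (0, -4, -3)]

/-- The shell together with the origin. [folklore] -/
def shellZ0 : List (ℤ × ℤ × ℤ) := (0, 0, 0) :: shellZ

/-- Distinct points of the scaled shell-with-origin are at squared distance `≥ 2`. [folklore] -/
theorem two_le_isq : ∀ a ∈ shellZ0, ∀ b ∈ shellZ0, a ≠ b → 2 ≤ isq a b := by decide

/-- Shell points have squared norm `25`. [folklore] -/
theorem isq_zero_eq : ∀ a ∈ shellZ, isq (0, 0, 0) a = 25 := by decide

/-- Shell-with-origin points have last coordinate in `[-5, 0]`. [folklore] -/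
theorem last_coord_bounds : ∀ a ∈ shellZ0, a.2.2 ≤ 0 ∧ -5 ≤ a.2.2 := by decide

/-- The shell has `21` elements (as a finset). [folklore] -/
theorem card_shellZ : shellZ.toFinset.card = 21 := by decide

/-- The origin is not a shell point. [folklore] -/
theorem zero_not_mem_shellZ : ((0 : ℤ), (0 : ℤ), (0 : ℤ)) ∉ shellZ := by decide

/-! ## §2 The configuration -/

/-- The point of `ℝ³` with coordinates `a/5`. [folklore] -/
def toE (a : ℤ × ℤ × ℤ) : E3 := !₂[(a.1 : ℝ) / 5, (a.2.1 : ℝ) / 5, (a.2.2 : ℝ) / 5]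

/-- The deep point `(0, 0, -n)`. [folklore] -/
def deep (n : ℕ) : E3 := !₂[(0 : ℝ), 0, -(n : ℝ)]

/-- The witness configuration: origin, shell, and the deep points `(0,0,-n)`, `n ≥ 2`. [folklore] -/
def Y : Set E3 := {p | ∃ a ∈ shellZ0, p = toE a} ∪ {p | ∃ n : ℕ, 2 ≤ n ∧ p = deep n}

/-- The inward normal `nrm3 = e₃` (the `u` of the stub). [folklore] -/
def nrm3 : E3 := EuclideanSpace.single 2 1

/-- The origin triple maps to `0`. [folklore] -/
theorem toE_zero : toE (0, 0, 0) = 0 := by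
  ext i; fin_cases i <;> simp [toE]

/-- Distances of scaled points: `dist (a/5) (b/5) = √(isq a b)/5`. [folklore] -/
theorem dist_toE (a b : ℤ × ℤ × ℤ) : dist (toE a) (toE b) = Real.sqrt (isq a b) / 5 := by
  rw [EuclideanSpace.dist_eq]
  simp only [toE, isq]
  simp [Fin.sum_univ_three, Real.dist_eq, sq_abs]
  rw [show ((a.1 : ℝ) / 5 - (b.1 : ℝ) / 5) ^ 2 + ((a.2.1 : ℝ) / 5 - (b.2.1 : ℝ) / 5) ^ 2 +
      ((a.2.2 : ℝ) / 5 - (b.2.2 : ℝ) / 5) ^ 2 =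
      (((a.1 : ℝ) - b.1) ^ 2 + ((a.2.1 : ℝ) - b.2.1) ^ 2 + ((a.2.2 : ℝ) - b.2.2) ^ 2) / 5 ^ 2 by ring]
  rw [Real.sqrt_div' _ (by norm_num : (0:ℝ) ≤ 5 ^ 2), Real.sqrt_sq (by norm_num : (0:ℝ) ≤ 5)]

/-- `toE` is injective. [folklore] -/
theorem toE_injective : Function.Injective toE := by
  intro a b h
  have h0 := congrArg (fun p : E3 => p.ofLp 0) h
  have h1 := congrArg (fun p : E3 => p.ofLp 1) h
  have h2 := congrArg (fun p : E3 => p.ofLp 2) h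
  simp [toE] at h0 h1 h2
  have e0 : a.1 = b.1 := by exact_mod_cast h0
  have e1 : a.2.1 = b.2.1 := by exact_mod_cast h1
  have e2 : a.2.2 = b.2.2 := by exact_mod_cast h2
  exact Prod.ext e0 (Prod.ext e1 e2)

/-- `0 ∈ Y`. [folklore] -/
theorem zero_mem_Y : (0 : E3) ∈ Y :=
  Or.inl ⟨(0, 0, 0), by simp [shellZ0], toE_zero.symm⟩

/-- Distinct shell-with-origin points are `≥ √2/5 ≥ 1/4` apart. [folklore] -/
theorem quarter_le_dist_toE {a b : ℤ × ℤ × ℤ} (ha : a ∈ shellZ0) (hb : b ∈ shellZ0) (hab : a ≠ b) :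
    1 / 4 ≤ dist (toE a) (toE b) := by
  rw [dist_toE]
  have h2 : (2 : ℝ) ≤ (isq a b : ℝ) := by exact_mod_cast two_le_isq a ha b hb hab
  have hs : (5 / 4 : ℝ) ≤ Real.sqrt (isq a b) := by
    rw [Real.le_sqrt (by linarith)]
    all_goals nlinarith [h2]
  linarith

/-- Last coordinate of a deep point. [folklore] -/
theorem deep_apply_two (n : ℕ) : (deep n).ofLp 2 = -(n : ℝ) := by simp [deep]

/-- Last coordinate of a scaled point. [folklore] -/
theorem toE_apply_two (a : ℤ × ℤ × ℤ) : (toE a).ofLp 2 = (a.2.2 : ℝ) / 5 := by simp [toE]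

/-- A shell-with-origin point and a deep point are `≥ 1` apart (compare last coordinates). [folklore] -/
theorem one_le_dist_toE_deep {a : ℤ × ℤ × ℤ} (ha : a ∈ shellZ0) {n : ℕ} (hn : 2 ≤ n) :
    1 ≤ dist (toE a) (deep n) := by
  have h := PiLp.dist_apply_le (toE a) (deep n) 2
  rw [toE_apply_two, deep_apply_two, Real.dist_eq] at h
  have hb : (-5 : ℝ) ≤ (a.2.2 : ℝ) := by exact_mod_cast (last_coord_bounds a ha).2
  have hn' : (2 : ℝ) ≤ n := by exact_mod_cast hn
  have : (1 : ℝ) ≤ |(a.2.2 : ℝ) / 5 - -(n : ℝ)| := by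
    rw [le_abs]; left; linarith
  exact this.trans h

/-- Distinct deep points are `≥ 1` apart. [folklore] -/
theorem one_le_dist_deep {n m : ℕ} (hnm : n ≠ m) : 1 ≤ dist (deep n) (deep m) := by
  have h := PiLp.dist_apply_le (deep n) (deep m) 2
  rw [deep_apply_two, deep_apply_two, Real.dist_eq] at h
  have : (1 : ℝ) ≤ |(-(n : ℝ)) - -(m : ℝ)| := by
    rw [show (-(n : ℝ)) - -(m : ℝ) = ((m : ℤ) - (n : ℤ) : ℤ) by push_cast; ring]
    have hz : (1 : ℤ) ≤ |(m : ℤ) - (n : ℤ)| := Int.one_le_abs (by omega)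
    rw [show |(((m : ℤ) - (n : ℤ) : ℤ) : ℝ)| = ((|(m : ℤ) - (n : ℤ)| : ℤ) : ℝ) by push_cast; rfl]
    exact_mod_cast hz
  exact this.trans h

/-- `Y` is `1/4`-separated. [folklore] -/
theorem Y_separated : ∀ p ∈ Y, ∀ q ∈ Y, p ≠ q → 1 / 4 ≤ dist p q := by
  rintro p (⟨a, ha, rfl⟩ | ⟨n, hn, rfl⟩) q (⟨b, hb, rfl⟩ | ⟨m, hm, rfl⟩) hpq
  · exact quarter_le_dist_toE ha hb fun h => hpq (by rw [h])
  · linarith [one_le_dist_toE_deep ha hm]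
  · rw [dist_comm]; linarith [one_le_dist_toE_deep hb hn]
  · linarith [one_le_dist_deep (n := n) (m := m) fun h => hpq (by rw [h])]

/-- `‖nrm3‖ = 1`. [folklore] -/
theorem norm_nrm3 : ‖nrm3‖ = 1 := by simp [nrm3]

/-- `⟪q, nrm3⟫` is the last coordinate of `q`. [folklore] -/
theorem inner_nrm3 (q : E3) : inner ℝ q nrm3 = q.ofLp 2 := by
  rw [nrm3, EuclideanSpace.inner_single_right]; simp

/-- `Y` lies in the closed lower half-space. [folklore] -/
theorem Y_halfSpace : ∀ q ∈ Y, inner ℝ q nrm3 ≤ 0 := by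
  rintro q (⟨a, ha, rfl⟩ | ⟨n, -, rfl⟩)
  · rw [inner_nrm3, toE_apply_two]
    have : (a.2.2 : ℝ) ≤ 0 := by exact_mod_cast (last_coord_bounds a ha).1
    linarith
  · rw [inner_nrm3, deep_apply_two]
    have : (0 : ℝ) ≤ n := n.cast_nonneg
    linarith

/-- `Y` is thick (points at every depth). [folklore] -/
theorem Y_thick : ∀ t : ℝ, ∃ q ∈ Y, inner ℝ q nrm3 < -t := by
  intro t
  refine ⟨deep (⌈t⌉₊ + 2), Or.inr ⟨⌈t⌉₊ + 2, by omega, rfl⟩, ?_⟩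
  rw [inner_nrm3, deep_apply_two]
  have h1 : t ≤ (⌈t⌉₊ : ℝ) := Nat.le_ceil t
  push_cast
  linarith

/-! ## §3 The top-site sum -/

/-- Every point of `Y` other than `0` is at distance `≥ 1` from `0`. [folklore] -/
theorem one_le_dist_zero_of_mem_Y {q : E3} (hq : q ∈ Y) (hq0 : q ≠ 0) : 1 ≤ dist 0 q := by
  rcases hq with ⟨a, ha, rfl⟩ | ⟨n, hn, rfl⟩
  · have ha' : a ∈ shellZ := by
      simp only [shellZ0, List.mem_cons] at ha
      rcases ha with rfl | ha
      · exact absurd toE_zero hq0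
      · exact ha
    rw [← toE_zero, dist_toE]
    have : (isq (0, 0, 0) a : ℝ) = 25 := by exact_mod_cast isq_zero_eq a ha'
    rw [this, show (25 : ℝ) = 5 ^ 2 by norm_num, Real.sqrt_sq (by norm_num)]
    norm_num
  · rw [← toE_zero]
    exact one_le_dist_toE_deep (by simp [shellZ0]) hn

/-- Shell points are at distance exactly `1` from `0`. [folklore] -/
theorem dist_zero_toE_of_mem_shellZ {a : ℤ × ℤ × ℤ} (ha : a ∈ shellZ) : dist 0 (toE a) = 1 := by
  rw [← toE_zero, dist_toE]
  have : (isq (0, 0, 0) a : ℝ) = 25 := by exact_mod_cast isq_zero_eq a ha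
  rw [this, show (25 : ℝ) = 5 ^ 2 by norm_num, Real.sqrt_sq (by norm_num)]
  norm_num

/-- The shell, as a finset of points of `Y ∖ {0}`. [folklore] -/
def shellEmb : {a // a ∈ shellZ.toFinset} ↪ {q : E3 // q ∈ Y ∧ q ≠ 0} where
  toFun a := ⟨toE a.1, Or.inl ⟨a.1, by
      have := a.2; rw [List.mem_toFinset] at this; simp [shellZ0, this], rfl⟩, by
      intro h
      have ha : a.1 ∈ shellZ := by have := a.2; rwa [List.mem_toFinset] at this
      have : a.1 = (0, 0, 0) := toE_injective (h.trans toE_zero.symm)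
      exact zero_not_mem_shellZ (this ▸ ha)⟩
  inj' a b h := by
    have : toE a.1 = toE b.1 := congrArg (fun q : {q : E3 // q ∈ Y ∧ q ≠ 0} => q.1) h
    exact Subtype.ext (toE_injective this)

/-- **The top site of `Y` is bound at `≤ -7/4`.** [folklore] -/
theorem tsum_top_le :
    ∑' q : {q : E3 // q ∈ Y ∧ q ≠ 0}, lennardJones (dist 0 q.1) ≤ -(7 / 4) := by
  set f : {q : E3 // q ∈ Y ∧ q ≠ 0} → ℝ := fun q => lennardJones (dist 0 q.1) with hf
  have hsum : Summable f := summable_site (X := Y) (by norm_num : (0:ℝ) < 1 / 4) Y_separated zero_mem_Y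
  have hnonpos : ∀ q, f q ≤ 0 := fun q =>
    lennardJones_nonpos (one_le_dist_zero_of_mem_Y q.2.1 q.2.2)
  -- the finite shell part
  set s : Finset {q : E3 // q ∈ Y ∧ q ≠ 0} := (shellZ.toFinset).attach.map shellEmb with hs
  have hsum_s : ∑ q ∈ s, f q = -(7 / 4) := by
    rw [hs, Finset.sum_map]
    have : ∀ a ∈ (shellZ.toFinset).attach, f (shellEmb a) = -1 / 12 := by
      intro a _
      have ha : a.1 ∈ shellZ := by have := a.2; rwa [List.mem_toFinset] at this
      show lennardJones (dist 0 (toE a.1)) = -1 / 12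
      rw [dist_zero_toE_of_mem_shellZ ha, lennardJones_one]
    rw [Finset.sum_congr rfl this, Finset.sum_const, Finset.card_attach, card_shellZ]
    norm_num
  -- `∑' f ≤ ∑_s f` since all terms are `≤ 0`
  have hneg : ∑ q ∈ s, (-f q) ≤ ∑' q, (-f q) :=
    hsum.neg.sum_le_tsum s fun q _ => neg_nonneg.2 (hnonpos q)
  rw [Finset.sum_neg_distrib, tsum_neg] at hneg
  linarith

/-! ## §4 Depth zero does not suffice -/

/-- **All hypotheses of `(CORE)` except the site bounds away from the top site are jointly satisfiable,
with the top site bound at `-7/4 < -711/500` (indeed `< -1.435 ≥ 2e*`).** [folklore] -/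
theorem exists_halfSpace_topSite_bound :
    ∃ (Y : Set (EuclideanSpace ℝ (Fin 3))) (u : EuclideanSpace ℝ (Fin 3)), ‖u‖ = 1 ∧
      (0 : EuclideanSpace ℝ (Fin 3)) ∈ Y ∧
      (∀ p ∈ Y, ∀ q ∈ Y, p ≠ q → 1 / 4 ≤ dist p q) ∧
      (∀ q ∈ Y, inner ℝ q u ≤ 0) ∧
      (∀ t : ℝ, ∃ q ∈ Y, inner ℝ q u < -t) ∧
      ∑' q : {q : EuclideanSpace ℝ (Fin 3) // q ∈ Y ∧ q ≠ 0}, lennardJones (dist 0 q.1) ≤ -(7 / 4) :=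
  ⟨Y, nrm3, norm_nrm3, zero_mem_Y, Y_separated, Y_halfSpace, Y_thick, tsum_top_le⟩

/-- **`(CORE)` is false at depth zero**: the strengthening of `stub_halfSpaceCore` that keeps the site
bound only at the top site `0` fails (so every proof of `(CORE)` uses the bound at other sites). [folklore] -/
theorem core_depthZero_false :
    ¬ ∀ (Y : Set (EuclideanSpace ℝ (Fin 3))) (u : EuclideanSpace ℝ (Fin 3)), ‖u‖ = 1 →
      (0 : EuclideanSpace ℝ (Fin 3)) ∈ Y →
      (∀ p ∈ Y, ∀ q ∈ Y, p ≠ q → 1 / 4 ≤ dist p q) →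
      (∀ q ∈ Y, inner ℝ q u ≤ 0) →
      (∀ t : ℝ, ∃ q ∈ Y, inner ℝ q u < -t) →
      ∑' q : {q : EuclideanSpace ℝ (Fin 3) // q ∈ Y ∧ q ≠ 0}, lennardJones (dist 0 q.1) ≤ -(711 / 500) →
      False := by
  intro h
  obtain ⟨Y, u, hu, h0, hsep, hhalf, hthick, htop⟩ := exists_halfSpace_topSite_bound
  exact h Y u hu h0 hsep hhalf hthick (htop.trans (by norm_num))

/-- The same at the certified level `1435/1000` (and at any level `≥ -7/4`). [folklore] -/
theorem core_depthZero_false' {lam : ℝ} (hlam : lam ≤ 7 / 4) :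
    ¬ ∀ (Y : Set (EuclideanSpace ℝ (Fin 3))) (u : EuclideanSpace ℝ (Fin 3)), ‖u‖ = 1 →
      (0 : EuclideanSpace ℝ (Fin 3)) ∈ Y →
      (∀ p ∈ Y, ∀ q ∈ Y, p ≠ q → 1 / 4 ≤ dist p q) →
      (∀ q ∈ Y, inner ℝ q u ≤ 0) →
      (∀ t : ℝ, ∃ q ∈ Y, inner ℝ q u < -t) →
      ∑' q : {q : EuclideanSpace ℝ (Fin 3) // q ∈ Y ∧ q ≠ 0}, lennardJones (dist 0 q.1) ≤ -lam →
      False := by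
  intro h
  obtain ⟨Y, u, hu, h0, hsep, hhalf, hthick, htop⟩ := exists_halfSpace_topSite_bound
  exact h Y u hu h0 hsep hhalf hthick (htop.trans (by linarith))

end Summit.AtomisticToContinuum.Crystallization.Theorems.UniformBindingRigidity.Negative.DepthZero

end
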